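/-
Copyright: b2b-lace packet (CARVER gen 56).  [FvdH17] Lemma 5.1, weighted displays (lemmapercboundXi1-4), (-7), (-8)
and their proof in §6.1 ((Psi-R-x), (lemmapercboundXi1-7-step2)): the CRUDE weighted (`Δ`) `x`-space bounds of the
`N ≤ 1` remainders `Ξ_R^{(N)}`, `Ψ_{R,I}^{(N),ι}`, `Ψ_{R,II}^{(N),ι}` of an abstract NoBLE split, in transfer form, from
TWO genuine bounds `Σ_x Ξ^{(N)}(x) ≤ B` and `Σ_x ‖x‖₂² Ξ^{(N)}(x) ≤ B_Δ`.  Proofs only; no named fact; no numeral; no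
dimension.
-/
import Literature.Probability.FitznerVanDerHofstad2017.NobleRemainderBound
import Literature.Probability.FitznerVanDerHofstad2017.NobleBoundsN0Proofs
import HarnessLib

/-!
# [FvdH17] Lemma 5.1, weighted remainder rows, crude form: `Σ ‖x‖² Ξ_R ≤ B_Δ`, `Σ ‖x−e_ι‖² Ψ_{R,I} ≤ (p/μ_p)(B + B_Δ)`, `Σ ‖x‖² Ψ_{R,II} ≤ (p/μ_p) B_Δ`

CITATION HEADER (PLACEMENT v2). This module is part of a certified REPRODUCTION of:
R. Fitzner, R. van der Hofstad, *Mean-field behavior for nearest-neighbor percolation in `d > 10`*, Electron. J.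
Probab. **22** (2017) no. 43 [FvdH17] (arXiv:1506.07977v2), Lemma 5.1 "Bounds on `Ξ^{(1)}_p` and `Ψ^{(1),κ}_p`"
(v2 p. 50; TeX source of the extended version `Bounds/BoundNOne.tex` l.36–60), the weighted displays
(lemmapercboundXi1-4) `Σ_x ‖x‖₂² Ξ^{(1)}_{R,p}(x) ≤ β^{(1)}_{ΔΞ} − (H^{(2)})_{0,0} + Σ_{ι,x} ‖x‖₂² 𝓣_{1̲,1,2}(e_ι,x,0)`,
(lemmapercboundXi1-7) `Σ_x ‖x − e_κ‖₂² Ψ^{(1),κ}_{R,I,p}(x) ≤ (p/μ_p)(β^{(1)}_{ΔΞ} + P⃗^S Ā^ι P⃗^E)`,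
(lemmapercboundXi1-8) `Σ_x ‖x‖₂² Ψ^{(1),κ}_{R,II,p}(x) ≤ (p/μ_p)(β^{(1)}_{ΔΞ} − (H^{(2)})_{0,0} + Σ_{ι,x} ‖x‖₂² 𝓣_{1̲,1,2}(e_ι,x,0))`,
and their proof in §6.1 (v2 p. 60; `Bounds/BoundsProof.tex` l.224–237): display (Psi-R-x)
`Ψ^{(1),κ}_{R,I,p}(x) ≤ Ψ^{(N),κ}_p(x) ≤ (p/μ_p) Ξ^{(N)}_p(x)`, then "we first use symmetry to perform the sum over `κ`,
then apply `‖x − e_κ‖₂² = ‖x‖₂² − 2x_κ + 1` and (Psi-R-x), to obtain (lemmapercboundXi1-7-step2)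
`Σ_x ‖x − e_κ‖₂² Ψ^{(1),κ}_{R,I,p}(x) ≤ (1/2d)(p/μ_p) Σ_{x,κ} (‖x‖₂² − 2x_κ + 1) Ξ^{(1)}_p(x) = (p/μ_p) Σ_x (‖x‖₂² + 1) Ξ^{(1)}_p(x)`.
In the second step we have used that `Ξ^{(1)}_p(x)` is symmetric to conclude that `x_κ Ξ^{(1)}_p(x)` vanishes when we sum
over `x`"; together with R. Fitzner, R. van der Hofstad, *Generalized approach to the non-backtracking lace expansion*,
Probab. Theory Related Fields **169** (2017) 1041–1119 [NoBLE17], §4.1.1 (pp. 1080–1081: the remainders are the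
coefficient minus a non-negative `α`-part) and Assumption 4.3 (p. 1087: the weighted remainder constants
`β^{(N)}_{ΔΞ,R}`, `β^{(N)}_{ΔΨ,R,I}`, `β^{(N)}_{ΔΨ,R,II}` the analysis consumes).  Origin: build `lace` (host summit
CriticalPhenomena), CARVER seat; node N76-E3CRUDE-DELTA (leaf L5.5 of the REV15 precondition census, Row E3, in
transfer form), the weighted twin of `NobleRemainderCrudeN1`.

WHAT THIS FILE DOES (all `d`-generic; `S : NobleSplit d p` an ABSTRACT split; `e_κ = stepVec κ`; `‖x‖₂ = euclidNorm x`;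
TRANSFER FORM `SumLE f B` = "`f` summable with `Σ' f ≤ B`").  (A) Folklore on weights: for a reflection-symmetric
`F ≥ 0` (`F(−x) = F(x)`) with `Σ F` and `Σ ‖x‖₂² F` finite, the odd term `Σ_x ⟨x,e⟩ F(x)` vanishes and
`Σ_x ‖x − e_κ‖₂² F(x) = Σ_x F(x) + Σ_x ‖x‖₂² F(x)` (the printed "`x_κ Ξ^{(1)}(x)` vanishes when we sum over `x`"; the
print sums over `κ` as well, per `κ` the point reflection `x ↦ −x` does the same).  (B) For `Ξ^{(N)}_p` (reflection
symmetric: `nobleXiN_neg`): `Σ_x ‖x − e_κ‖₂² Ξ^{(N)}(x) ≤ B + B_Δ` from `Σ_x Ξ^{(N)} ≤ B`, `Σ_x ‖x‖₂² Ξ^{(N)} ≤ B_Δ`.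
(C) The weighted single-direction transfer (Psi-R-x): for any weight `w ≥ 0`, `Σ_x w(x) Ψ^{(N),κ}(x) ≤ (p/μ_p) B'`
from `Σ_x w(x) Ξ^{(N)}(x) ≤ B'` (`2 ≤ d`, `p < p_c`: `Ψ^{(N),κ} ≤ (p/μ_p) Ξ^{(N)}` pointwise, `noblePsiN_le`).
(D) The field shapes of `NobleInputValid` at `N ≤ 1`: `SumLE (‖·‖₂² · S.xiR N) B_Δ` ((lemmapercboundXi1-4) crude:
remainder ≤ coefficient), `SumLE (‖· − e_ι‖₂² · S.psiRI N ι) ((p/μ_p)(B + B_Δ))` ((lemmapercboundXi1-7), exactly the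
printed bound), `SumLE (‖·‖₂² · S.psiRII N ι) ((p/μ_p) B_Δ)` ((lemmapercboundXi1-8) crude), every `ι`, packaged as
one triple.

"Crude" = without the printed "(0,0)-square device" `−(H^{(2)})_{0,0} + Σ_{ι,x} ‖x‖₂² 𝓣_{1̲,1,2}(e_ι,x,0)` of
(lemmapercboundXi1-4)/(-8), which is NOT typed here; (lemmapercboundXi1-7) carries no device in print.  The two inputs
`B` ((lemmapercboundXi1-1), `Σ_x Ξ^{(1)} ≤ P⃗^S Ā^ι P⃗^E`) and `B_Δ` ((lemmapercboundXi1-2), `Σ_x ‖x‖₂² Ξ^{(1)} ≤ β^{(1)}_{ΔΞ}`)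
are BINDERS of every theorem: nothing here asserts their values.  Nothing landed is modified; no cited hypothesis —
every statement is a kernel-proved inequality between landed definitions.
-/

noncomputable section

namespace Literature.Probability.FitznerVanDerHofstad2017

open _root_.MeasureTheory Finset
open scoped BigOperators ENNReal
open Literature.Probability.LatticeModels Literature.Probability.Percolation
open Literature.Barriers.CriticalPhenomena

variable {d : ℕ} {p : unitInterval}

/-! ## A. Weights: the odd term vanishes for a reflection-symmetric function; `Σ ‖x − e_κ‖₂² F = Σ F + Σ ‖x‖₂² F` -/

/-- **The odd term vanishes**: `Σ_y ⟨y,e⟩ F(y) = 0` for every `F` with `F(−y) = F(y)` (reflection `y ↦ −y`; holds for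
the junk value too, no summability needed). [cite: FitznerVanDerHofstad2017, §6.1 proof of Lemma 5.1, text after (lemmapercboundXi1-7-step2) ("x_κ Ξ^{(1)}_p(x) vanishes when we sum over x") (arXiv:1506.07977v2 p. 60)] -/
theorem tsum_inner_mul_eq_zero_of_neg_invariant {F : Site d → ℝ} (hF : ∀ y, F (-y) = F y) (e : Site d) :
    ∑' y : Site d, (∑ j, (y j : ℝ) * (e j : ℝ)) * F y = 0 :=
  tsum_eq_zero_of_odd fun y => by rw [inner_neg_left, hF, neg_mul]

/-- `y ↦ ⟨y,e_κ⟩ F(y)` is summable once `Σ F` and `Σ ‖y‖₂² F` are (`F ≥ 0`; `2|⟨y,e_κ⟩| ≤ ‖y‖₂² + 1`) — the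
summability behind the print's term-wise expansion of `Σ_x ‖x − e_κ‖₂² F(x)`. [folklore]
[cite: FitznerVanDerHofstad2017, §6.1 proof of Lemma 5.1, (lemmapercboundXi1-7-step2) (arXiv:1506.07977v2 p. 60)] -/
private theorem summable_inner_stepVec_mul_of_summable {F : Site d → ℝ} (hF0 : ∀ y, 0 ≤ F y) (κ : Fin d × Bool)
    (h1 : Summable F) (h2 : Summable (fun y => euclidNorm y ^ 2 * F y)) :
    Summable (fun y : Site d => (∑ j, (y j : ℝ) * ((stepVec κ) j : ℝ)) * F y) := by
  refine (h2.add h1).of_norm_bounded fun y => ?_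
  rw [Real.norm_eq_abs, abs_mul, abs_of_nonneg (hF0 y)]
  have h2' := two_mul_abs_inner_le y (stepVec κ)
  rw [euclidNorm_stepVec, one_pow] at h2'
  have hle : |∑ j, (y j : ℝ) * ((stepVec κ) j : ℝ)| ≤ euclidNorm y ^ 2 + 1 := by
    linarith [abs_nonneg (∑ j, (y j : ℝ) * ((stepVec κ) j : ℝ))]
  calc |∑ j, (y j : ℝ) * ((stepVec κ) j : ℝ)| * F y ≤ (euclidNorm y ^ 2 + 1) * F y :=
        mul_le_mul_of_nonneg_right hle (hF0 y)
    _ = euclidNorm y ^ 2 * F y + F y := by ring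

/-- **`Σ_x ‖x − e_κ‖₂² F(x) = Σ_x F(x) + Σ_x ‖x‖₂² F(x)`** for a reflection-symmetric `F ≥ 0` with both right-hand
sums finite (`‖x − e_κ‖₂² = ‖x‖₂² − 2x_κ + 1`, odd term zero), with the summability of the left side.
[cite: FitznerVanDerHofstad2017, §6.1 proof of Lemma 5.1, (lemmapercboundXi1-7-step2) (arXiv:1506.07977v2 p. 60)] -/
theorem recentered_second_moment_of_neg_invariant {F : Site d → ℝ} (hF0 : ∀ y, 0 ≤ F y) (hF : ∀ y, F (-y) = F y)
    (κ : Fin d × Bool) (h1 : Summable F) (h2 : Summable (fun y => euclidNorm y ^ 2 * F y)) :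
    Summable (fun x => euclidNorm (x - stepVec κ) ^ 2 * F x) ∧
      ∑' x, euclidNorm (x - stepVec κ) ^ 2 * F x = ∑' x, F x + ∑' x, euclidNorm x ^ 2 * F x := by
  have he1 : euclidNorm (stepVec κ) ^ 2 = 1 := by rw [euclidNorm_stepVec, one_pow]
  have hexp : ∀ x : Site d, euclidNorm (x - stepVec κ) ^ 2 * F x =
      (F x + euclidNorm x ^ 2 * F x) - 2 * ((∑ j, (x j : ℝ) * ((stepVec κ) j : ℝ)) * F x) := by
    intro x
    rw [euclidNorm_sub_sq, he1]
    ring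
  have hc := summable_inner_stepVec_mul_of_summable hF0 κ h1 h2
  simp only [hexp]
  refine ⟨(h1.add h2).sub (hc.mul_left 2), ?_⟩
  rw [(h1.add h2).tsum_sub (hc.mul_left 2), tsum_mul_left, tsum_inner_mul_eq_zero_of_neg_invariant hF, mul_zero,
    sub_zero, h1.tsum_add h2]

/-- `SumLE` (summable + `tsum ≤`) passes from a majorant to a non-negative minorant (domination of non-negative
functions) — a copy of the one-liner of `NobleRemainderCrudeN1` kept private here. [folklore] -/
private theorem sumLE_of_nonneg_of_le_w {f g : Site d → ℝ} {B : ℝ} (hg : SumLE g B) (h0 : ∀ x, 0 ≤ f x)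
    (hle : ∀ x, f x ≤ g x) : SumLE f B :=
  ⟨hg.1.of_nonneg_of_le h0 hle, ((hg.1.of_nonneg_of_le h0 hle).tsum_le_tsum hle hg.1).trans hg.2⟩

/-! ## B. `Ξ^{(N)}_p` is reflection symmetric: `Σ_x ‖x − e_κ‖₂² Ξ^{(N)}(x) ≤ B + B_Δ` -/

/-- **`Σ_x ‖x − e_κ‖₂² Ξ^{(N)}_p(x) ≤ B + B_Δ`** from `Σ_x Ξ^{(N)}_p(x) ≤ B` and `Σ_x ‖x‖₂² Ξ^{(N)}_p(x) ≤ B_Δ` (genuine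
sums; every `N`, every `κ`): `Ξ^{(N)}_p(−x) = Ξ^{(N)}_p(x)` (`nobleXiN_neg`) kills the odd term.
[cite: FitznerVanDerHofstad2017, §6.1 proof of Lemma 5.1, (lemmapercboundXi1-7-step2) and the sentence after it (arXiv:1506.07977v2 p. 60); §3.5 first display (p. 32)] -/
theorem sumLE_normSqSub_nobleXiN (p : unitInterval) (N : ℕ) (κ : Fin d × Bool) {B BΔ : ℝ}
    (hB : SumLE (nobleXiN d p N) B) (hΔ : SumLE (fun x => euclidNorm x ^ 2 * nobleXiN d p N x) BΔ) :
    SumLE (fun x => euclidNorm (x - stepVec κ) ^ 2 * nobleXiN d p N x) (B + BΔ) := by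
  obtain ⟨hs, ht⟩ := recentered_second_moment_of_neg_invariant (nobleXiN_nonneg p N)
    (fun y => (nobleXiN_neg p N y).symm) κ hB.1 hΔ.1
  refine ⟨hs, ?_⟩
  rw [ht]
  exact add_le_add hB.2 hΔ.2

/-! ## C. The weighted single-direction transfer (Psi-R-x): `Σ_x w Ψ^{(N),κ} ≤ (p/μ_p) Σ_x w Ξ^{(N)}` -/

/-- **`Σ_x w(x) Ψ^{(N),κ}_p(x) ≤ (p/μ_p) B'`** from `Σ_x w(x) Ξ^{(N)}_p(x) ≤ B'`, for every weight `w ≥ 0`, every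
direction `κ` and every `N` (`2 ≤ d`, `p < p_c`): (Psi-R-x) `Ψ^{(N),κ}_p(x) ≤ (p/μ_p) Ξ^{(N)}_p(x)` pointwise
(`noblePsiN_le`, [FvdH17] (3.74)) and domination of non-negative functions.
[cite: FitznerVanDerHofstad2017, §6.1 proof of Lemma 5.1, (Psi-R-x) (arXiv:1506.07977v2 p. 60); §3.5 (3.74) (p. 32)] -/
theorem sumLE_mul_noblePsiN_of_sumLE_mul_nobleXiN (hd : 2 ≤ d) (hp : p < criticalProbI d) {N : ℕ}
    {w : Site d → ℝ} (hw : ∀ x, 0 ≤ w x) {B : ℝ} (h : SumLE (fun x => w x * nobleXiN d p N x) B)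
    (κ : Fin d × Bool) : SumLE (fun x => w x * noblePsiN d p (stepVec κ) N x) ((p : ℝ) / nobleMu d p * B) := by
  have hμ : 0 ≤ (p : ℝ) / nobleMu d p := div_nonneg p.2.1 (nobleMu_nonneg d p)
  have hle : ∀ x, w x * noblePsiN d p (stepVec κ) N x ≤ (p : ℝ) / nobleMu d p * (w x * nobleXiN d p N x) :=
    fun x => by
      rw [mul_left_comm]
      exact mul_le_mul_of_nonneg_left (noblePsiN_le p (stepVec κ) N x hμ (nobleXiT_ne_top hd hp N x)) (hw x)
  have hnn : ∀ x, 0 ≤ w x * noblePsiN d p (stepVec κ) N x :=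
    fun x => mul_nonneg (hw x) (noblePsiN_nonneg' p _ N x)
  have hg : Summable (fun x => (p : ℝ) / nobleMu d p * (w x * nobleXiN d p N x)) := h.1.mul_left _
  have hs : Summable (fun x => w x * noblePsiN d p (stepVec κ) N x) := hg.of_nonneg_of_le hnn hle
  refine ⟨hs, (hs.tsum_le_tsum hle hg).trans ?_⟩
  rw [tsum_mul_left]
  exact mul_le_mul_of_nonneg_left h.2 hμ

/-- **`Σ_x ‖x‖₂² Ψ^{(N),κ}_p(x) ≤ (p/μ_p) B_Δ`** from `Σ_x ‖x‖₂² Ξ^{(N)}_p(x) ≤ B_Δ` (`2 ≤ d`, `p < p_c`; every `κ`, `N`).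
[cite: FitznerVanDerHofstad2017, §6.1 proof of Lemma 5.1, (Psi-R-x) (arXiv:1506.07977v2 p. 60)] -/
theorem sumLE_normSq_noblePsiN_of_sumLE (hd : 2 ≤ d) (hp : p < criticalProbI d) {N : ℕ} {BΔ : ℝ}
    (hΔ : SumLE (fun x => euclidNorm x ^ 2 * nobleXiN d p N x) BΔ) (κ : Fin d × Bool) :
    SumLE (fun x => euclidNorm x ^ 2 * noblePsiN d p (stepVec κ) N x) ((p : ℝ) / nobleMu d p * BΔ) :=
  sumLE_mul_noblePsiN_of_sumLE_mul_nobleXiN hd hp (fun _ => sq_nonneg _) hΔ κ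

/-- **(lemmapercboundXi1-7-step2)**: `Σ_x ‖x − e_κ‖₂² Ψ^{(N),κ}_p(x) ≤ (p/μ_p)(B + B_Δ)` from `Σ_x Ξ^{(N)}_p(x) ≤ B` and
`Σ_x ‖x‖₂² Ξ^{(N)}_p(x) ≤ B_Δ` (`2 ≤ d`, `p < p_c`; every `κ`, `N`).
[cite: FitznerVanDerHofstad2017, §6.1 proof of Lemma 5.1, (Psi-R-x)–(lemmapercboundXi1-7-step2) (arXiv:1506.07977v2 p. 60)] -/
theorem sumLE_normSqSub_noblePsiN_of_sumLE (hd : 2 ≤ d) (hp : p < criticalProbI d) {N : ℕ} {B BΔ : ℝ}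
    (hB : SumLE (nobleXiN d p N) B) (hΔ : SumLE (fun x => euclidNorm x ^ 2 * nobleXiN d p N x) BΔ)
    (κ : Fin d × Bool) :
    SumLE (fun x => euclidNorm (x - stepVec κ) ^ 2 * noblePsiN d p (stepVec κ) N x)
      ((p : ℝ) / nobleMu d p * (B + BΔ)) :=
  sumLE_mul_noblePsiN_of_sumLE_mul_nobleXiN hd hp (fun _ => sq_nonneg _) (sumLE_normSqSub_nobleXiN p N κ hB hΔ) κ

/-! ## D. The weighted field shapes of `NobleInputValid` at `N ≤ 1` from the two binders `B`, `B_Δ` -/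

namespace NobleSplit

variable (S : NobleSplit d p)

/-- `Ξ_R^{(N)}(x) ≤ Ξ^{(N)}(x)` (`N ≤ 1`; `Ξ_α ≥ 0`) — private copy of the one-liner of `NobleRemainderCrudeN1`.
[cite: FitznerVanDerHofstad2016NoBLE, §4.1.1 ("non-negative functions", pp. 1080–1081)] -/
private theorem xiR_le_nobleXiN_w {N : ℕ} (hN : N ≤ 1) (x : Site d) : S.xiR N x ≤ nobleXiN d p N x :=
  sub_le_self _ (S.xiA_nonneg N hN x)

/-- `0 ≤ Ψ_{R,I}^{(N),ι}(x)` (`N ≤ 1`) — private copy. [cite: FitznerVanDerHofstad2016NoBLE, §4.1.1 (pp. 1080–1081)] -/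
private theorem psiRI_nonneg_w {N : ℕ} (hN : N ≤ 1) (ι : Fin d × Bool) (x : Site d) : 0 ≤ S.psiRI N ι x :=
  sub_nonneg.2 (S.psiAI_le N hN ι x)

/-- `Ψ_{R,I}^{(N),ι}(x) ≤ Ψ^{(N),ι}(x)` (`N ≤ 1`) — (Psi-R-x), first inequality; private copy.
[cite: FitznerVanDerHofstad2017, §6.1 proof of Lemma 5.1, (Psi-R-x) (arXiv:1506.07977v2 p. 60)] -/
private theorem psiRI_le_noblePsiN_w {N : ℕ} (hN : N ≤ 1) (ι : Fin d × Bool) (x : Site d) :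
    S.psiRI N ι x ≤ noblePsiN d p (stepVec ι) N x :=
  sub_le_self _ (S.psiAI_nonneg N hN ι x)

/-- `0 ≤ Ψ_{R,II}^{(N),ι}(x)` (`N ≤ 1`) — private copy. [cite: FitznerVanDerHofstad2016NoBLE, §4.1.1 (pp. 1080–1081)] -/
private theorem psiRII_nonneg_w {N : ℕ} (hN : N ≤ 1) (ι : Fin d × Bool) (x : Site d) : 0 ≤ S.psiRII N ι x :=
  sub_nonneg.2 (S.psiAII_le N hN ι x)

/-- `Ψ_{R,II}^{(N),ι}(x) ≤ Ψ^{(N),ι}(x)` (`N ≤ 1`) — private copy. [cite: FitznerVanDerHofstad2016NoBLE, §4.1.1 (pp. 1080–1081)] -/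
private theorem psiRII_le_noblePsiN_w {N : ℕ} (hN : N ≤ 1) (ι : Fin d × Bool) (x : Site d) :
    S.psiRII N ι x ≤ noblePsiN d p (stepVec ι) N x :=
  sub_le_self _ (S.psiAII_nonneg N hN ι x)

/-- **(lemmapercboundXi1-4) crude** — the field shape `xiR1Delta` (and its `N = 0` twin): `Σ_x ‖x‖₂² Ξ^{(N)}(x) ≤ B_Δ
⟹ Σ_x ‖x‖₂² Ξ_R^{(N)}(x) ≤ B_Δ` as genuine sums (`N ≤ 1`; remainder ≤ coefficient).
[cite: FitznerVanDerHofstad2017, Lemma 5.1 (lemmapercboundXi1-4) (arXiv:1506.07977v2 p. 50)] [cite: FitznerVanDerHofstad2016NoBLE, §4.1.1 and Assumption 4.3 (pp. 1080–1081, 1087)] -/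
theorem sumLE_normSq_xiR_of_sumLE {N : ℕ} (hN : N ≤ 1) {BΔ : ℝ}
    (hΔ : SumLE (fun x => euclidNorm x ^ 2 * nobleXiN d p N x) BΔ) :
    SumLE (fun x => euclidNorm x ^ 2 * S.xiR N x) BΔ :=
  sumLE_of_nonneg_of_le_w hΔ (fun x => mul_nonneg (sq_nonneg _) (S.xiR_nonneg hN x))
    fun x => mul_le_mul_of_nonneg_left (S.xiR_le_nobleXiN_w hN x) (sq_nonneg _)

/-- **(lemmapercboundXi1-7)** — the field shape `psiRI1Delta` (and its `N = 0` twin): `Σ_x Ξ^{(N)} ≤ B`,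
`Σ_x ‖x‖₂² Ξ^{(N)} ≤ B_Δ ⟹ Σ_x ‖x − e_ι‖₂² Ψ_{R,I}^{(N),ι}(x) ≤ (p/μ_p)(B + B_Δ)` as genuine sums (`N ≤ 1`, `2 ≤ d`,
`p < p_c`; every `ι`) — exactly the printed bound, whose proof extracts nothing from `Ψ_{R,I}`.
[cite: FitznerVanDerHofstad2017, Lemma 5.1 (lemmapercboundXi1-7) (arXiv:1506.07977v2 p. 50); §6.1 (Psi-R-x)–(lemmapercboundXi1-7-step2) (p. 60)] [cite: FitznerVanDerHofstad2016NoBLE, Assumption 4.3 (p. 1087)] -/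
theorem sumLE_normSqSub_psiRI_of_sumLE (hd : 2 ≤ d) (hp : p < criticalProbI d) {N : ℕ} (hN : N ≤ 1) {B BΔ : ℝ}
    (hB : SumLE (nobleXiN d p N) B) (hΔ : SumLE (fun x => euclidNorm x ^ 2 * nobleXiN d p N x) BΔ)
    (ι : Fin d × Bool) :
    SumLE (fun x => euclidNorm (x - stepVec ι) ^ 2 * S.psiRI N ι x) ((p : ℝ) / nobleMu d p * (B + BΔ)) :=
  sumLE_of_nonneg_of_le_w (sumLE_normSqSub_noblePsiN_of_sumLE hd hp hB hΔ ι)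
    (fun x => mul_nonneg (sq_nonneg _) (S.psiRI_nonneg_w hN ι x))
    fun x => mul_le_mul_of_nonneg_left (S.psiRI_le_noblePsiN_w hN ι x) (sq_nonneg _)

/-- **(lemmapercboundXi1-8) crude** — the field shape `psiRII1Delta` (and its `N = 0` twin): `Σ_x ‖x‖₂² Ξ^{(N)} ≤ B_Δ
⟹ Σ_x ‖x‖₂² Ψ_{R,II}^{(N),ι}(x) ≤ (p/μ_p) B_Δ` as genuine sums (`N ≤ 1`, `2 ≤ d`, `p < p_c`; every `ι`).
[cite: FitznerVanDerHofstad2017, Lemma 5.1 (lemmapercboundXi1-8) (arXiv:1506.07977v2 p. 50); §6.1 (Psi-R-x) (p. 60)] [cite: FitznerVanDerHofstad2016NoBLE, Assumption 4.3 (p. 1087)] -/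
theorem sumLE_normSq_psiRII_of_sumLE (hd : 2 ≤ d) (hp : p < criticalProbI d) {N : ℕ} (hN : N ≤ 1) {BΔ : ℝ}
    (hΔ : SumLE (fun x => euclidNorm x ^ 2 * nobleXiN d p N x) BΔ) (ι : Fin d × Bool) :
    SumLE (fun x => euclidNorm x ^ 2 * S.psiRII N ι x) ((p : ℝ) / nobleMu d p * BΔ) :=
  sumLE_of_nonneg_of_le_w (sumLE_normSq_noblePsiN_of_sumLE hd hp hΔ ι)
    (fun x => mul_nonneg (sq_nonneg _) (S.psiRII_nonneg_w hN ι x))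
    fun x => mul_le_mul_of_nonneg_left (S.psiRII_le_noblePsiN_w hN ι x) (sq_nonneg _)

/-- **(lemmapercboundXi1-4), (-7), (-8) crude, packaged**: from the TWO genuine bounds `Σ_x Ξ^{(N)}_p(x) ≤ B` and
`Σ_x ‖x‖₂² Ξ^{(N)}_p(x) ≤ B_Δ` (`N ≤ 1`, `2 ≤ d`, `p < p_c`) the three weighted remainder rows
`Σ_x ‖x‖₂² Ξ_R^{(N)} ≤ B_Δ`, `Σ_x ‖x − e_ι‖₂² Ψ_{R,I}^{(N),ι} ≤ (p/μ_p)(B + B_Δ)`, `Σ_x ‖x‖₂² Ψ_{R,II}^{(N),ι} ≤ (p/μ_p) B_Δ`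
(every `ι`), as genuine sums.
[cite: FitznerVanDerHofstad2017, Lemma 5.1 (lemmapercboundXi1-4), (-7), (-8) (arXiv:1506.07977v2 p. 50); §6.1 (p. 60)] [cite: FitznerVanDerHofstad2016NoBLE, Assumption 4.3 (p. 1087)] -/
theorem sumLE_remaindersDelta_crude_of_sumLE (hd : 2 ≤ d) (hp : p < criticalProbI d) {N : ℕ} (hN : N ≤ 1)
    {B BΔ : ℝ} (hB : SumLE (nobleXiN d p N) B) (hΔ : SumLE (fun x => euclidNorm x ^ 2 * nobleXiN d p N x) BΔ) :
    SumLE (fun x => euclidNorm x ^ 2 * S.xiR N x) BΔ ∧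
      (∀ ι, SumLE (fun x => euclidNorm (x - stepVec ι) ^ 2 * S.psiRI N ι x) ((p : ℝ) / nobleMu d p * (B + BΔ))) ∧
        ∀ ι, SumLE (fun x => euclidNorm x ^ 2 * S.psiRII N ι x) ((p : ℝ) / nobleMu d p * BΔ) :=
  ⟨S.sumLE_normSq_xiR_of_sumLE hN hΔ, fun ι => S.sumLE_normSqSub_psiRI_of_sumLE hd hp hN hB hΔ ι,
    fun ι => S.sumLE_normSq_psiRII_of_sumLE hd hp hN hΔ ι⟩

end NobleSplit

end Literature.Probability.FitznerVanDerHofstad2017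

end
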